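import Mathlib
import HarnessLib
import Summits.HubbardSuperconductivity.HubbardSuperconductivity.Theorems.BalabanIRBirComplexStableXYReality
import Summits.HubbardSuperconductivity.HubbardSuperconductivity.Theorems.BalabanIRBirComplexStableXYWitnessContinuity

/-!
# BalabanIR engine `BirComplexStableXYR` (stmt-14845) / reduction `BirGappedPhaseReductionR` (stmt-14846):
# hidden positivity — core lemmas

Support file for route BalabanIR (`--supports stmt-HubbardSuperconductivity-14846`; prover seat 2,
session 10).  The restated engine `Theses.BalabanIR.BirComplexStableXYR` quantifies over the class of
finite Fourier tables `c` with (U1) charge neutrality, (N) `Σ c = 0`, (A) `Σ ‖c_n‖ e^{|n|₁} ≤ B`,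
(C) coercivity `c₀ ΣΣ(1 − cos(φ_w − φ_w')) ≤ Re F_c`, (R) time-reflection Hermiticity
`c (n ∘ R) = conj (c (−n))` and (P) inversion evenness, and concludes `Z ≠ 0 ∧ slice order ≥ 1/2`.

This file proves, in the vocabulary of `Theorems/BirComplexStableXY/Negative/WitnessTable.lean`
(`Table`, `genF`, `action`, `partZ`, `normA`, `tsum`, `cube` — verbatim sub-expressions of the crux):

* the class is closed under the **reflection-conjugate** `c ↦ c'`, `c' n = conj (c (−n))`
  (`genF_conjReflect : F_{c'} = conj ∘ F_c`, `normA_conjReflect`, `tsum_conjReflect`,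
  `condU1/condR/condP_conjReflect`) and under real convex combinations (`condR_real_lincomb`,
  `condP_lincomb`, `normA_lincomb_le`, `tsum_lincomb`, `genF_lincomb`);
* the **real-part table** `(c + c')/2` has `F = Re F_c` (`genF_realPart`), the same (A)-bound
  (`normA_realPart_le`), (N), (U1), (R), (P), and a POSITIVE partition function
  (`re_partZ_realPart_pos`: a positive continuous integrand on a cube of positive measure);
* along the **segment** `c_t = (1−t)(c+c')/2 + t c` the real part of `F` is constant
  (`re_genF_segment`, so (C) holds with the same `c₀`), `t ↦ Z_{c_t}` is continuous
  (`continuous_partZ_segment`, parametric integral over the compact cube), and therefore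
  (`re_partZ_pos_of_segment`, intermediate value theorem `re_pos_of_ne_zero_on_path`):
  if `Z_{c_t}` is real and non-zero for all `t ∈ [0,1]` then `0 < Re Z_c`.

The companion file `BalabanIRBirComplexStableXYRPositivity.lean` feeds these into the crux verbatim:
`BirComplexStableXYR` is EQUIVALENT to its positive form (`0 < Re Z` for every admissible table), i.e.
the "positivity-free" engine as typed secretly asserts positivity of every class partition function at
all even `M ≥ L ≥ L₀`, `K ≥ K₀`.  No definitions, no hypotheses beyond the lemma statements. [folklore]
-/

noncomputable section

namespace Summit.HubbardSuperconductivity.HubbardSuperconductivity.Theorems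

open scoped BigOperators ComplexConjugate
open MeasureTheory Literature.Probability.LatticeModels
open Summit.HubbardSuperconductivity.BirComplexStableXYNegative
open Summit.HubbardSuperconductivity.HubbardSuperconductivity.Theses.BalabanIR

variable {r : ℕ}

/-! ### The reflection-conjugate table `c' n = conj (c (-n))` -/

/-- The reflection-conjugate table exists (an explicit `Finsupp`): `c' n = conj (c (-n))`. -/
theorem conjReflect_apply (c : Table r) (n : Freq r) :
    (Finsupp.equivMapDomain (Equiv.neg (Freq r))
      (Finsupp.mapRange (starRingEnd ℂ) (map_zero _) c)) n = conj (c (-n)) := by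
  simp [Finsupp.equivMapDomain_apply]

/-- A table determined pointwise by `c' n = conj (c (-n))` IS that explicit `Finsupp`. -/
theorem eq_conjReflect_of_apply (c c' : Table r) (hcc : ∀ n, c' n = conj (c (-n))) :
    c' = Finsupp.equivMapDomain (Equiv.neg (Freq r))
      (Finsupp.mapRange (starRingEnd ℂ) (map_zero _) c) := by
  ext n
  rw [conjReflect_apply, hcc]

/-- The generating function of the reflection-conjugate table is the complex conjugate:
`F_{c'} = conj ∘ F_c` (real window configurations). -/
theorem genF_conjReflect (c c' : Table r) (hcc : ∀ n, c' n = conj (c (-n))) (φ : W r → ℝ) :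
    genF c' φ = conj (genF c φ) := by
  rw [eq_conjReflect_of_apply c c' hcc]
  unfold genF
  rw [Finsupp.sum_equivMapDomain, Finsupp.sum_mapRange_index (fun _ => by simp), map_finsuppSum]
  refine Finsupp.sum_congr fun n _ => ?_
  rw [map_mul, ← Complex.exp_conj, map_mul, Complex.conj_I, Complex.conj_ofReal]
  congr 2
  simp only [Equiv.neg_apply, Pi.neg_apply, Int.cast_neg, neg_mul, Finset.sum_neg_distrib,
    Complex.ofReal_neg]
  ring

/-- The (A)-norm is reflection-conjugation invariant. -/
theorem normA_conjReflect (c c' : Table r) (hcc : ∀ n, c' n = conj (c (-n))) :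
    normA c' = normA c := by
  rw [eq_conjReflect_of_apply c c' hcc]
  unfold normA
  rw [Finsupp.sum_equivMapDomain, Finsupp.sum_mapRange_index (fun _ => by simp)]
  refine Finsupp.sum_congr fun n _ => ?_
  simp only [Equiv.neg_apply, Pi.neg_apply, Int.cast_neg, abs_neg, RCLike.norm_conj]

/-- The coefficient sum of the reflection-conjugate table is the conjugate. -/
theorem tsum_conjReflect (c c' : Table r) (hcc : ∀ n, c' n = conj (c (-n))) :
    BirComplexStableXYNegative.tsum c' = conj (BirComplexStableXYNegative.tsum c) := by
  rw [eq_conjReflect_of_apply c c' hcc]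
  unfold BirComplexStableXYNegative.tsum
  rw [Finsupp.sum_equivMapDomain, Finsupp.sum_mapRange_index (fun _ => rfl), map_finsuppSum]

/-- (U1) charge neutrality passes to the reflection-conjugate table. -/
theorem condU1_conjReflect (c c' : Table r) (hcc : ∀ n, c' n = conj (c (-n)))
    (hU : ∀ n ∈ c.support, ∑ w, n w = 0) : ∀ n ∈ c'.support, ∑ w, n w = 0 := by
  intro n hn
  have h1 : c (-n) ≠ 0 := by
    have h2 : c' n ≠ 0 := Finsupp.mem_support_iff.mp hn
    rw [hcc] at h2
    exact fun h0 => h2 (by rw [h0, map_zero])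
  have h3 := hU (-n) (Finsupp.mem_support_iff.mpr h1)
  simp only [Pi.neg_apply, Finset.sum_neg_distrib, neg_eq_zero] at h3
  exact h3

/-- (R) time-reflection Hermiticity passes to the reflection-conjugate table. -/
theorem condR_conjReflect (c c' : Table r) (hcc : ∀ n, c' n = conj (c (-n)))
    (hR : ∀ n : Freq r, c (fun w => n (w.1, w.2.1, Fin.rev w.2.2)) = conj (c (-n))) :
    ∀ n : Freq r, c' (fun w => n (w.1, w.2.1, Fin.rev w.2.2)) = conj (c' (-n)) := by
  intro n
  rw [hcc, hcc, neg_neg]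
  have h1 : -(fun w : W r => n (w.1, w.2.1, Fin.rev w.2.2)) =
      fun w : W r => (-n) (w.1, w.2.1, Fin.rev w.2.2) := rfl
  rw [h1, hR (-n), neg_neg]

/-- (P) inversion evenness passes to the reflection-conjugate table. -/
theorem condP_conjReflect (c c' : Table r) (hcc : ∀ n, c' n = conj (c (-n)))
    (hP : ∀ n : Freq r, c (fun w => n (Fin.rev w.1, Fin.rev w.2.1, w.2.2)) = c n) :
    ∀ n : Freq r, c' (fun w => n (Fin.rev w.1, Fin.rev w.2.1, w.2.2)) = c' n := by
  intro n
  rw [hcc, hcc]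
  have h1 : -(fun w : W r => n (Fin.rev w.1, Fin.rev w.2.1, w.2.2)) =
      fun w : W r => (-n) (Fin.rev w.1, Fin.rev w.2.1, w.2.2) := rfl
  rw [h1, hP (-n)]

/-! ### Real linear combinations stay in the class -/

/-- (R) is stable under real linear combinations. -/
theorem condR_real_lincomb (x y : ℝ) (c₁ c₂ : Table r)
    (h₁ : ∀ n : Freq r, c₁ (fun w => n (w.1, w.2.1, Fin.rev w.2.2)) = conj (c₁ (-n)))
    (h₂ : ∀ n : Freq r, c₂ (fun w => n (w.1, w.2.1, Fin.rev w.2.2)) = conj (c₂ (-n))) :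
    ∀ n : Freq r, ((x : ℂ) • c₁ + (y : ℂ) • c₂) (fun w => n (w.1, w.2.1, Fin.rev w.2.2)) =
      conj (((x : ℂ) • c₁ + (y : ℂ) • c₂) (-n)) := by
  intro n
  simp only [Finsupp.add_apply, Finsupp.smul_apply, smul_eq_mul, h₁ n, h₂ n, map_add, map_mul,
    Complex.conj_ofReal]

/-- (P) is stable under linear combinations. -/
theorem condP_lincomb (x y : ℂ) (c₁ c₂ : Table r)
    (h₁ : ∀ n : Freq r, c₁ (fun w => n (Fin.rev w.1, Fin.rev w.2.1, w.2.2)) = c₁ n)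
    (h₂ : ∀ n : Freq r, c₂ (fun w => n (Fin.rev w.1, Fin.rev w.2.1, w.2.2)) = c₂ n) :
    ∀ n : Freq r, (x • c₁ + y • c₂) (fun w => n (Fin.rev w.1, Fin.rev w.2.1, w.2.2)) =
      (x • c₁ + y • c₂) n := by
  intro n
  simp only [Finsupp.add_apply, Finsupp.smul_apply, h₁ n, h₂ n]

/-- (A) is convex: the weighted norm of a real combination with non-negative weights. -/
theorem normA_lincomb_le {x y : ℝ} (hx : 0 ≤ x) (hy : 0 ≤ y) (c₁ c₂ : Table r) :
    normA ((x : ℂ) • c₁ + (y : ℂ) • c₂) ≤ x * normA c₁ + y * normA c₂ := by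
  refine (normA_add_le _ _).trans (le_of_eq ?_)
  rw [normA_smul, normA_smul, Complex.norm_real, Complex.norm_real, Real.norm_of_nonneg hx,
    Real.norm_of_nonneg hy]

/-- (N) for a linear combination. -/
theorem tsum_lincomb (x y : ℂ) (c₁ c₂ : Table r) :
    BirComplexStableXYNegative.tsum (x • c₁ + y • c₂) =
      x * BirComplexStableXYNegative.tsum c₁ + y * BirComplexStableXYNegative.tsum c₂ := by
  rw [tsum_add, tsum_smul, tsum_smul]

/-- `F` of a linear combination. -/
theorem genF_lincomb (x y : ℂ) (c₁ c₂ : Table r) (φ : W r → ℝ) :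
    genF (x • c₁ + y • c₂) φ = x * genF c₁ φ + y * genF c₂ φ := by
  rw [genF_add, genF_smul, genF_smul]

/-! ### The real-part table `(c + c')/2` -/

/-- The generating function of the real-part table `(c + c')/2` is `Re F_c` (a real number). -/
theorem genF_realPart (c c' : Table r) (hcc : ∀ n, c' n = conj (c (-n))) (φ : W r → ℝ) :
    genF ((1/2 : ℂ) • (c + c')) φ = (((genF c φ).re : ℝ) : ℂ) := by
  rw [genF_smul, genF_add, genF_conjReflect c c' hcc, Complex.add_conj]
  push_cast
  ring

/-- The real-part table has the same (A)-norm bound: `normA ((c + c')/2) ≤ normA c`. -/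
theorem normA_realPart_le (c c' : Table r) (hcc : ∀ n, c' n = conj (c (-n))) :
    normA ((1/2 : ℂ) • (c + c')) ≤ normA c := by
  rw [normA_smul]
  have h := normA_add_le c c'
  rw [normA_conjReflect c c' hcc] at h
  have h2 : ‖(1/2 : ℂ)‖ = 1/2 := by simp
  rw [h2]
  linarith

/-- The real-part table satisfies (N) when `c` does. -/
theorem tsum_realPart (c c' : Table r) (hcc : ∀ n, c' n = conj (c (-n)))
    (hN : BirComplexStableXYNegative.tsum c = 0) :
    BirComplexStableXYNegative.tsum ((1/2 : ℂ) • (c + c')) = 0 := by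
  rw [tsum_smul, tsum_add, tsum_conjReflect c c' hcc, hN, map_zero, add_zero, mul_zero]

/-- The real-part table satisfies (U1) when `c` does. -/
theorem condU1_realPart (c c' : Table r) (hcc : ∀ n, c' n = conj (c (-n)))
    (hU : ∀ n ∈ c.support, ∑ w, n w = 0) :
    ∀ n ∈ ((1/2 : ℂ) • (c + c')).support, ∑ w, n w = 0 :=
  condU1_smul _ (condU1_add hU (condU1_conjReflect c c' hcc hU))

/-- The real-part table satisfies (R) when `c` does. -/
theorem condR_realPart (c c' : Table r) (hcc : ∀ n, c' n = conj (c (-n)))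
    (hR : ∀ n : Freq r, c (fun w => n (w.1, w.2.1, Fin.rev w.2.2)) = conj (c (-n))) :
    ∀ n : Freq r, ((1/2 : ℂ) • (c + c')) (fun w => n (w.1, w.2.1, Fin.rev w.2.2)) =
      conj (((1/2 : ℂ) • (c + c')) (-n)) := by
  intro n
  have h' := condR_conjReflect c c' hcc hR n
  simp only [Finsupp.smul_apply, Finsupp.add_apply, smul_eq_mul, hR n, h', map_mul, map_add,
    map_div₀, map_one, map_ofNat]

/-- The real-part table satisfies (P) when `c` does. -/
theorem condP_realPart (c c' : Table r) (hcc : ∀ n, c' n = conj (c (-n)))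
    (hP : ∀ n : Freq r, c (fun w => n (Fin.rev w.1, Fin.rev w.2.1, w.2.2)) = c n) :
    ∀ n : Freq r, ((1/2 : ℂ) • (c + c')) (fun w => n (Fin.rev w.1, Fin.rev w.2.1, w.2.2)) =
      ((1/2 : ℂ) • (c + c')) n := by
  intro n
  have h' := condP_conjReflect c c' hcc hP n
  simp only [Finsupp.smul_apply, Finsupp.add_apply, hP n, h']


/-! ### The segment from the real-part table to `c` -/

/-- The segment table `c_t = (1-t)·(c+c')/2 + t·c` has generating function
`F_{c_t} = (1-t)·Re F_c + t·F_c`. -/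
theorem genF_segment (c c' : Table r) (hcc : ∀ n, c' n = conj (c (-n))) (t : ℝ) (φ : W r → ℝ) :
    genF ((((1 - t : ℝ)) : ℂ) • ((1/2 : ℂ) • (c + c')) + ((t : ℝ) : ℂ) • c) φ =
      (((1 - t : ℝ)) : ℂ) * ((((genF c φ).re : ℝ)) : ℂ) + ((t : ℝ) : ℂ) * genF c φ := by
  rw [genF_lincomb, genF_realPart c c' hcc]

/-- Along the segment the REAL part of the generating function is constant: `Re F_{c_t} = Re F_c`
(so coercivity (C) and the modulus of the Boltzmann weight do not see `t`). -/
theorem re_genF_segment (c c' : Table r) (hcc : ∀ n, c' n = conj (c (-n))) (t : ℝ) (φ : W r → ℝ) :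
    (genF ((((1 - t : ℝ)) : ℂ) • ((1/2 : ℂ) • (c + c')) + ((t : ℝ) : ℂ) • c) φ).re = (genF c φ).re := by
  rw [genF_segment c c' hcc]
  simp only [Complex.add_re, Complex.re_ofReal_mul, Complex.ofReal_re]
  ring

/-- The Boltzmann weight of the real-part table is a positive real number:
`exp(-A_{(c+c')/2} θ) = exp(-K Σ_s Re F_c(θ ∘ sh s))`. -/
theorem exp_neg_action_realPart (K : ℝ) (c c' : Table r) (hcc : ∀ n, c' n = conj (c (-n)))
    (L M : ℕ) [NeZero L] [NeZero M] (θ : Λ L M → ℝ) :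
    Complex.exp (-(action K ((1/2 : ℂ) • (c + c')) L M θ)) =
      ((Real.exp (-(K * ∑ s : Λ L M, (genF c (fun w => θ (sh L M s w))).re)) : ℝ) : ℂ) := by
  unfold action
  simp only [genF_realPart c c' hcc]
  rw [Complex.ofReal_exp]
  push_cast
  rfl

/-- The statement's cube `[0,2π]^Λ` has positive Lebesgue measure. -/
theorem volume_birCube_pos (L M : ℕ) [NeZero L] [NeZero M] : 0 < volume (cube L M) := by
  unfold cube
  rw [volume_pi_pi]
  refine pos_iff_ne_zero.mpr (Finset.prod_ne_zero_iff.mpr fun i _ => ?_)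
  rw [Real.volume_Icc, sub_zero, ne_eq, ENNReal.ofReal_eq_zero, not_le]
  positivity

/-- **The real-part table has a positive partition function**: `0 < Re Z_{(c+c')/2}` (the integrand
is a positive continuous function on a cube of positive measure). -/
theorem re_partZ_realPart_pos (K : ℝ) (c c' : Table r) (hcc : ∀ n, c' n = conj (c (-n)))
    (L M : ℕ) [NeZero L] [NeZero M] :
    0 < (partZ K ((1/2 : ℂ) • (c + c')) L M).re := by
  unfold partZ
  simp_rw [exp_neg_action_realPart K c c' hcc L M]
  rw [integral_complex_ofReal, Complex.ofReal_re]
  have hK : IsCompact (cube L M) := isCompact_univ_pi fun _ => isCompact_Icc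
  have hcont : Continuous fun θ : Λ L M → ℝ =>
      Real.exp (-(K * ∑ s : Λ L M, (genF c (fun w => θ (sh L M s w))).re)) := by
    fun_prop
  have hint : IntegrableOn (fun θ : Λ L M → ℝ =>
      Real.exp (-(K * ∑ s : Λ L M, (genF c (fun w => θ (sh L M s w))).re))) (cube L M) volume :=
    hcont.continuousOn.integrableOn_compact hK
  rw [setIntegral_pos_iff_support_of_nonneg_ae
    (Filter.Eventually.of_forall fun θ => (Real.exp_pos _).le) hint]
  have hsupp : Function.support (fun θ : Λ L M → ℝ =>
      Real.exp (-(K * ∑ s : Λ L M, (genF c (fun w => θ (sh L M s w))).re))) = Set.univ :=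
    Set.eq_univ_of_forall fun θ => (Real.exp_pos _).ne'
  rw [hsupp, Set.univ_inter]
  exact volume_birCube_pos L M

/-- **Continuity of the partition function along the segment** `t ↦ Z_{c_t}` (parametric integral
of a jointly continuous integrand over the compact cube). -/
theorem continuous_partZ_segment (K : ℝ) (c c' : Table r) (hcc : ∀ n, c' n = conj (c (-n)))
    (L M : ℕ) [NeZero L] [NeZero M] :
    Continuous fun t : ℝ =>
      partZ K ((((1 - t : ℝ)) : ℂ) • ((1/2 : ℂ) • (c + c')) + ((t : ℝ) : ℂ) • c) L M := by
  unfold partZ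
  have hK : IsCompact (cube L M) := isCompact_univ_pi fun _ => isCompact_Icc
  refine continuous_parametric_integral_of_continuous (μ := volume)
    (f := fun (t : ℝ) (θ : Λ L M → ℝ) => Complex.exp (-(action K
      ((((1 - t : ℝ)) : ℂ) • ((1/2 : ℂ) • (c + c')) + ((t : ℝ) : ℂ) • c) L M θ))) ?_ hK
  have h : (fun (t : ℝ) (θ : Λ L M → ℝ) => Complex.exp (-(action K
      ((((1 - t : ℝ)) : ℂ) • ((1/2 : ℂ) • (c + c')) + ((t : ℝ) : ℂ) • c) L M θ))).uncurry =
      fun p : ℝ × (Λ L M → ℝ) => Complex.exp (-((K : ℂ) * ∑ s : Λ L M,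
        ((((1 - p.1 : ℝ)) : ℂ) * ((((genF c (fun w => p.2 (sh L M s w))).re : ℝ)) : ℂ) +
          ((p.1 : ℝ) : ℂ) * genF c (fun w => p.2 (sh L M s w))))) := by
    funext p
    rw [Function.uncurry_def]
    unfold action
    simp only [genF_segment c c' hcc]
  rw [h]
  fun_prop

/-- A continuous path of REAL complex numbers that never vanishes and starts positive ends
positive (intermediate value theorem). -/
theorem re_pos_of_ne_zero_on_path {f : ℝ → ℂ} (hf : Continuous f) (h0 : 0 < (f 0).re)
    (hne : ∀ t ∈ Set.Icc (0:ℝ) 1, f t ≠ 0) (him : ∀ t ∈ Set.Icc (0:ℝ) 1, (f t).im = 0) :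
    0 < (f 1).re := by
  by_contra hle
  rw [not_lt] at hle
  have hcont : ContinuousOn (fun t => (f t).re) (Set.Icc 0 1) :=
    (Complex.continuous_re.comp hf).continuousOn
  obtain ⟨t, ht, hft⟩ := intermediate_value_Icc' zero_le_one hcont ⟨hle, h0.le⟩
  refine hne t ht (Complex.ext ?_ ?_)
  · simpa using hft
  · simpa using him t ht

/-- **Positivity from non-vanishing on the segment (named form).** If `Z_{c_t} ≠ 0` and `Z_{c_t}`
is real for every `t ∈ [0,1]` along the segment from the real-part table `(c+c')/2` to `c`, then
`0 < Re Z_c`. -/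
theorem re_partZ_pos_of_segment (K : ℝ) (c c' : Table r) (hcc : ∀ n, c' n = conj (c (-n)))
    (L M : ℕ) [NeZero L] [NeZero M]
    (hne : ∀ t ∈ Set.Icc (0:ℝ) 1,
      partZ K ((((1 - t : ℝ)) : ℂ) • ((1/2 : ℂ) • (c + c')) + ((t : ℝ) : ℂ) • c) L M ≠ 0)
    (him : ∀ t ∈ Set.Icc (0:ℝ) 1,
      (partZ K ((((1 - t : ℝ)) : ℂ) • ((1/2 : ℂ) • (c + c')) + ((t : ℝ) : ℂ) • c) L M).im = 0) :
    0 < (partZ K c L M).re := by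
  have h := re_pos_of_ne_zero_on_path (continuous_partZ_segment K c c' hcc L M) ?_ hne him
  · simpa using h
  · simpa using re_partZ_realPart_pos K c c' hcc L M

end Summit.HubbardSuperconductivity.HubbardSuperconductivity.Theorems

end
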